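import Summits.BirchSwinnertonDyer.BirchSwinnertonDyer.Theorems.ClassRecordThreeEulerHalvesAtThreeKolyvaginFamilyLevelSupplyClosing
import Summits.BirchSwinnertonDyer.BirchSwinnertonDyer.Theorems.ClassRecordThreeCornerAtThreeShimuraWalkB6DDefs
import Summits.BirchSwinnertonDyer.BirchSwinnertonDyer.Theorems.ClassRecordThreeCornerAtThreeShimuraFamilyProducersLocal
import Summits.BirchSwinnertonDyer.BirchSwinnertonDyer.Theorems.ClassRecordThreeCornerAtThreeShimuraFamilyH47Orders
import Summits.BirchSwinnertonDyer.BirchSwinnertonDyer.Theorems.Rank1ResidualJetRingClassFields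
import HarnessLib

/-!
# PORT TARGET 2 ON THE B6D FRAME, CLOSED MODULO POITOU–TATE: `(∀ K, PT K) → ShimuraWalk.LevelSupplyAtThreeB6D`
# (cell `bsd-stepL`, seat `bsd-stepL-tam3-p1` g14, owner of 19109's line `Cruxes/EulerHalvesAtThree/Lines/inert.lean`;
# `--supports stmt-BirchSwinnertonDyer-19109 --as helper`; the B6D frame is shared with crux 21420 `CornerAtThreeW`)

WHAT. `ShimuraWalk.levelSupplyAtThreeB6D_of_poitouTate`: Poitou–Tate duality for Selmer structures with a conjugation-compatible
family of local invariant maps (`poitouTate_selmerStructure_duality_conj K` for every number field `K` — in the r8 skeleton DERIVED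
from the citable `stub_localFactsAtThree.1` as `hPT_of_localFactsAtThree`) IMPLIES the (B6)-keyed per-level inequality on the
restricted frame, `ShimuraWalk.LevelSupplyAtThreeB6D` (RULING 49 «B6D FRAME», corner3-p2 g8's p605681): for every CM family of
`X_{N⁺,N⁻}` at `3 ∈ S` over an imaginary quadratic `K` with `d_K < −4`, carrying the printed labels `LabelsAt` and the E⁰ label (B6)
at the primes of `N` outside `S`, and every prime `q ∉ S`, `LevelSupplyAt hK ι W N 3 ys (ord₃ c_q(E⁄ℚ_q))` (Jetchev 2008 Thm. 6.3 ∘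
Prop. 6.4 per conductor). This is EXACTLY the body of the r9 form of `stub_levelSupplyAtThree` (tam3-p1 g13's r9 note, RULING 49 (b)):
`(∀ K, PT K) → ShimuraWalk.LevelSupplyAtThreeB6D`.
HOW. `intro`s of the B6D frame; the case `ord₃ c_q = 0` is trivial; otherwise `q ∣ N` (`c_q ≠ 1`), every place `v ∋ q` of `K` is moved by
complex conjugation (two places over the split `q`, Cassels–Fröhlich VII 1.2 (ii)) and is BAD for `E/K` (bsd-jet's carrier row data
`c_v = c_q` and `c_v = 1` at good `v`); then THIS seat's END-GAME composition `Koly.levelSupplyAt_three_of_labels_of_familyProducers`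
(p605065) with its four displayed ∀-datum producers DISCHARGED by lane B (corner3-p2 g8): `hsign` =
`pointsMap_derivedPoint_familyData_of_labelsAt` (p605208, Gross 5.4), `hSel` = `kolyvaginClass_familyData_mem_selmerLocalKer_of_labelsAt`
(p605614, Gross 6.2 (1)), `hstrq` = `localization_kolyvaginClass_familyData_mem_stringentFamily_of_labelsAt` (p605614, Jetchev 4.9, at the
bad places over `q`), `h47` = `addOrderOf_localization_kolyvaginClass_familyData_eq_of_labels_of_admissible` (p605268, McCallum 4.4);
admissibility `hA` for every datum from `E[3]` irreducible (this seat's p603099); ring class fields are number fields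
(`JET.numberField_ringClassField`).
HONEST FRAMING. ONE theorem, CONDITIONAL on `hPT` only (a named, citable input: Milne ADT I Thm. 4.10, Cassels–Fröhlich VII §11); it
does NOT discharge the registered r8 stub `stub_levelSupplyAtThree : ShimuraWalk.LevelSupplyAtThreeB6` (un-restricted frame, no `hPT`
threading — the r9 re-point is OWED to the planner's registration); nothing about BSD, `J₃` or any divisibility of a Heegner point is
asserted unconditionally; no item closes; 0 classes move (T7); BSD is not proved by any of this.
References (locators only): [cite: Jetchev2008, Thm. 1.4, §6 Thm. 6.3, Prop. 6.4, Prop. 4.9] [cite: GrossLMS1991, Prop. 5.4, §6 Prop. 6.2 (1)]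
[cite: McCallumLMS1991, §4 Prop. 4.4] [cite: MilneADT2006, Ch. I, Thm. 4.10] [cite: CasselsFrohlichANT1967, Ch. VII Prop. 1.2 (ii), §11]
[cite: SilvermanAEC2009, VII.2 remark after Prop. 2.1].
presearch: not applicable (composition of tree theorems); `lean search 'levelSupplyAtThreeB6D_of'` → only the weakening
`levelSupplyAtThreeB6D_of_levelSupplyAtThreeB6`.
Design: `K : Type`. Axioms: `propext`, `Classical.choice`, `Quot.sound`.
-/

set_option autoImplicit false
set_option linter.dupNamespace false

noncomputable section

open scoped Classical NumberField Pointwise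

namespace Summit.BirchSwinnertonDyer.BirchSwinnertonDyer.Theorems.ShimuraWalk

open WeierstrassCurve IsDedekindDomain NumberField Field Function Literature.NumberTheory.EllipticCurves
  Literature.NumberTheory.EllipticCurves.ModularForms Literature.NumberTheory.EllipticCurves.Jetchev2008
  Literature.NumberTheory.EllipticCurves.KolyvaginCocycle
  Literature.NumberTheory.EllipticCurves.Rank1Residual Literature.NumberTheory.GaloisRepresentations
  Literature.NumberTheory.GaloisCohomology Literature.NumberTheory.Automorphic
  Summit.BirchSwinnertonDyer.Rank1Residual.JET Summit.BirchSwinnertonDyer.Rank1Residual.JET.SelmerVocabulary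
  Summit.BirchSwinnertonDyer.Rank1Residual.JET.Walk Summit.BirchSwinnertonDyer.Rank1Residual.JET.GlobalDuality
  Summit.BirchSwinnertonDyer.Rank1Residual.X11b Summit.BirchSwinnertonDyer.Rank1Residual.X11b.Three
  Summit.BirchSwinnertonDyer.BirchSwinnertonDyer.Theorems
  Literature.NumberTheory.EllipticCurves.ShimuraCMFamily

set_option maxHeartbeats 800000 in
/-- **`(∀ K, PT K) → ShimuraWalk.LevelSupplyAtThreeB6D`** — the (B6)-keyed per-level inequality of the carrier-inert Shimura road at
`3` on the restricted frame `d_K < −4`, from Poitou–Tate duality for Selmer structures alone: THIS seat's end-game composition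
`Koly.levelSupplyAt_three_of_labels_of_familyProducers` with lane B's ∀-datum producers (`hsign`, `hSel`, `hstrq`, `h47`) plugged in;
the places over the exempted split prime `q` are bad because `3 ∣ c_q`. The body of r9's `stub_levelSupplyAtThree`.
[cite: Jetchev2008, Thm. 1.4, Thm. 6.3, Prop. 6.4, Prop. 4.9] [cite: GrossLMS1991, Prop. 5.4, §6 Prop. 6.2 (1)]
[cite: McCallumLMS1991, §4 Prop. 4.4] [cite: MilneADT2006, Ch. I, Thm. 4.10] [cite: CasselsFrohlichANT1967, Ch. VII Prop. 1.2 (ii)] -/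
theorem levelSupplyAtThreeB6D_of_poitouTate
    (hPT : ∀ (K : Type) [Field K] [NumberField K], poitouTate_selmerStructure_duality_conj K) :
    LevelSupplyAtThreeB6D := by
  intro W _ _ N _ K _ _ S Dt X W' _ P₀ hN hirr hK hD _hS hin hsp h3S _hc _hmin ι y ys ε hL hB6 q _ hqS
  subst hN
  haveI : ∀ j : ℕ, NumberField (ringClassField K ι j) := numberField_ringClassField K hK ι
  have hp : (3 : ℕ).Prime := Fact.out
  have hp2 : (3 : ℕ) ≠ 2 := by decide
  have hq : q.Prime := Fact.out
  -- the trivial case `t = 0`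
  rcases Nat.eq_zero_or_pos (padicValNat 3 ((W.baseChange ℚ_[q]).localTamagawaNumber ℤ_[q])) with ht0 | htpos
  · rw [ht0]
    intro k c _ _ _
    simp
  -- `3 ∣ c_q`, so `q` is a bad prime: `q ∣ N`
  obtain ⟨vq, hqq⟩ : ∃ v : HeightOneSpectrum (𝓞 ℚ), (Rat.HeightOneSpectrum.primesEquiv v : ℕ) = q :=
    ⟨Rat.HeightOneSpectrum.primesEquiv.symm ⟨q, Fact.out⟩, by rw [Equiv.apply_symm_apply]⟩
  have hcq : (W.baseChange ℚ_[q]).localTamagawaNumber ℤ_[q] = W.tamagawaNumberAt vq :=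
    WeierstrassCurve.localTamagawaNumber_padic_eq_holds W vq q hqq
  have hc1 : (W.baseChange ℚ_[q]).localTamagawaNumber ℤ_[q] ≠ 1 := fun h1 ↦ by
    rw [h1, padicValNat_one_right] at htpos
    exact lt_irrefl 0 htpos
  have hbad : ¬ W.HasGoodReductionAt vq := fun hgood ↦
    hc1 (hcq.trans (WeierstrassCurve.localTamagawaNumber_eq_one_of_hasGoodReductionAt_holds W vq hgood))
  have hqN : q ∣ W.conductorNorm ℤ := by rw [← hqq]; exact (W.dvd_conductorNorm_iff vq).mpr hbad
  have hq2 := hsp q hq hqN hqS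
  -- `Gal(K/ℚ) = {1, τ}`
  haveI : Algebra.IsQuadraticExtension ℚ K := ⟨hK.1⟩
  have hcard : Nat.card (K ≃ₐ[ℚ] K) = 2 := by rw [IsGalois.card_aut_eq_finrank, hK.1]
  obtain ⟨τ, hτ, huniq⟩ := (Nat.card_eq_two_iff' (1 : K ≃ₐ[ℚ] K)).mp hcard
  have hτ2 : τ * τ = 1 := by
    rw [mul_eq_one_iff_eq_inv]
    exact (huniq τ⁻¹ (inv_ne_one.mpr hτ)).symm
  -- every place `v ∋ q` of `K` is moved by `τ` and is BAD for `E/K` (`c_v = c_q ≠ 1`)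
  obtain ⟨v₀, hv₀, -, hqv₀⟩ := exists_split_place_of_ncard_eq_two K hK τ hτ q hq2 hqN
  have hbadK : ∀ v : HeightOneSpectrum (𝓞 K), ((q : ℕ) : 𝓞 K) ∈ v.asIdeal →
      ¬ (W.baseChange K).HasGoodReductionAt v := by
    intro v hqv hgood
    obtain ⟨σ, hσ⟩ := HeightOneSpectrum.exists_algEquiv_smul_eq (F := ℚ) (w := v₀) (w' := v)
      (LocalField.heightOneSpectrum_rat_eq_of_natCast_mem q _ _
        (LocalField.natCast_mem_under q v₀ hqv₀) (LocalField.natCast_mem_under q v hqv))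
    have hτv : τ • v ≠ v := by
      by_cases hσ1 : σ = 1
      · subst hσ1
        rw [one_smul] at hσ
        subst hσ
        exact hv₀
      · have hστ : σ = τ := huniq σ hσ1
        subst hστ
        subst hσ
        rw [smul_smul, hτ2, one_smul]
        exact fun h ↦ hv₀ h.symm
    obtain ⟨-, -, hcEq, -, -⟩ := carrierRowData_of_split W K q hK τ v hτv hqv
    exact hc1 (hcEq.symm.trans
      ((W.baseChange K).localTamagawaNumber_eq_one_of_hasGoodReductionAt_holds v hgood))
  -- `3` is unramified in `K` (`3 ∈ S`), the Weil pairing; admissibility of `E(K[n])` for every datum (`E[3]` irreducible)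
  have hKunr := ShimuraKolyvaginOfImage.isUnramifiedIn_rat_of_not_dvd_discr K hp (hin 3 h3S).2.2.2.2
  have hW3 := WeierstrassCurve.exists_weilPairing_holds W 3
  have hA : ∀ (n : ℕ) (d : KolyvaginFamilyData W K ι n), d.y = ys n → Squarefree n →
      (∀ q' ∈ n.primeFactors, IsKolyvaginPrime (W.conductorNorm ℤ) W K 3 q') →
      ∀ j : ℕ, IsAdmissible (absoluteGaloisGroup K) d.pointsSubgroup ((3 ^ j : ℕ) : ℤ) :=
    fun n d _ hn hKP j ↦ d.isAdmissible_pointsSubgroup_family_of_hasIrreducibleModPGaloisRep hK hn.ne_zero hp hp2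
      hirr hW3 hKunr (fun h3n ↦ (hKP 3 (Nat.mem_primeFactors.mpr ⟨hp, h3n, hn.ne_zero⟩)).2.2.2.1 rfl) j
  -- the END-GAME composition with lane B's producers plugged in
  exact Koly.levelSupplyAt_three_of_labels_of_familyProducers W (W.conductorNorm ℤ) K S Dt rfl hirr hK hD hin hsp
    h3S ι hPT y ys ε hL q hqS
    (fun c hc n d hdy hn hKol j hj hjM ↦
      pointsMap_derivedPoint_familyData_of_labelsAt hK ι Dt hp ys hL hA hc (isLiftOfAut_liftAut c) n d hdy hn
        hKol j hj hjM)
    (fun M n d hM hdy hn hKol 𝔳 h𝔳 ↦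
      kolyvaginClass_familyData_mem_selmerLocalKer_of_labelsAt hK ι rfl Dt hirr hin hsp ys hL hB6 hA M n d hM
        hdy hn hKol 𝔳 h𝔳)
    (fun k hn' n d hk hdy hn hKol _ v hqv ↦
      localization_kolyvaginClass_familyData_mem_stringentFamily_of_labelsAt hK ι Dt hirr hsp ys hL hB6 hA q
        hqN hqS k hn' n d hk hdy hn hKol v hqv (hbadK v hqv))
    (fun k n n' d d' ℓ hk hdy hd'y hn hKol hℓ hℓn hn' v hv ↦
      addOrderOf_localization_kolyvaginClass_familyData_eq_of_labels_of_admissible hK hD ι rfl hp2 Dt ys hL hA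
        k n n' d d' ℓ hk hdy hd'y hn hKol hℓ hℓn hn' v hv)

end Summit.BirchSwinnertonDyer.BirchSwinnertonDyer.Theorems.ShimuraWalk

end
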